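import Literature.NumberTheory.Automorphic.HyperspecialUnitarySatakeTransformAdicCompletion
import Literature.NumberTheory.Automorphic.HyperspecialUnitarySatakeIsomorphismAdicCompletion
import Literature.NumberTheory.Automorphic.UnitaryRankOneUnramifiedCharacters
import HarnessLib

/-!
# R90 · S6 «Ch. 14.1–14.5 stable trace formula» — WAVE 3 card W3-b: the SATAKE-GRAPH PARTNER IS UNIQUE
# (`Theorems/R90S6SatakeGraphPartnerUnique.lean`; the Hecke eigencharacters `λ_{(z,1)}`, `z ∈ ℂˣ`, separate `ℋ(U(J₀,2)(E_w), K₀)`)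

Cell `hodgecm-mathlib`, crux H413 (`stmt-HodgeConjecture-24833`), route of record `HCCMUnconditional`; programme R90-TF, section S6
(base `R90-C14`), seat R90-C14-p03 (g0); S6 WAVE 3 OPEN CARDS (R90-C14-plan (g0), R90 bus 16:50:09Z), card W3-b of the sheet
`R90/R90-C14-plan/g0/S6_wave3_targets.v1.R90-C14-plan-g0.lean` 17c4113e7673ca44 :37–:41 (signature token-identical, namespace segment
`.Wave3` dropped).  Helper lane `--supports stmt-HodgeConjecture-24833 --as helper`; THEOREMS ONLY (no definition, no instance, no notation,
no named fact, no `sorry`); imports = ★ Literature Satake files + HarnessLib (no Lines import).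

THE PRINT [Rogawski1990, §4.5 p. 50 (unramified `σ_w` ↔ `W`-class of unramified characters of `T`), p. 55 `ξ̂_H(f)^∧(z) = f^∧(−z)` (the map
`f ↦ ξ̂_H(f)` whose graph is `Cruxes/H413/Lines/R90_S6_FloorE1D.lean` § (E1-c) `SatakeGraph`)]; [CartierCorvallis1979, §IV Thm. 4.1, Cor. 4.2]
(`ℋ(G, K) ≅ ℂ[Λ]^W`; the characters of `ℋ` are the `f ↦ 𝒮f(χ)`).  For `U(J₀, 2)(E_w)` at an inert unramified `w` the spherical Hecke
algebra is `ℂ[T₁]` with `𝒮(T₁) = x^{(1,-1)} + x^{(-1,1)}` (★ `UnramifiedLocalConjDatum.exists_generator_two`), and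
`λ_β(T₁) = z(β) + z(β)⁻¹`, `z(β) = β₀ β₁⁻¹` (★ `heckeEigencharacter_apply_generator`); at `β = (z, 1)` this is `z + z⁻¹`, so
`λ_{(z,1)}(P(T₁)) = P(z + z⁻¹)` and, `z ↦ z + z⁻¹` being onto `ℂ` (★ `exists_units_add_inv_eq`), the family `λ_{(z,1)}`, `z ∈ ℂˣ`,
SEPARATES `ℋ(U(J₀,2)(E_w), K₀)` (Mathlib `Polynomial.funext`).  Hence the Satake-graph partner `φ^H` of (E1-c) is unique.

* `unitaryHeckeEigencharacterAdic_two_aeval` — the computation `λ_{(z,1)}(P(T₁)) = P(z + z⁻¹)` for any generator `T₁` with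
  `𝒮_w(T₁) = x^{(1,-1)} + x^{(-1,1)}` (reusable by W3-d ∕ W3-d′);
* `exists_generator_unitaryHeckeAlgebraAdic_two` — such a `T₁` exists at `w` and generates (the adic packaging of ★ `exists_generator_two`);
* **`satakeGraph_partner_unique`** — W3-b.
HONEST LABEL: local spherical Hecke algebra bookkeeping; proves no printed global statement.  HC_CM is proved only modulo the 7 printed
citations (2 remaining named inputs: hLiu418 = stmt-HodgeConjecture-24832, h413 = stmt-HodgeConjecture-24833) until rung 0 closes.

## References
* [Rogawski1990] J. D. Rogawski, *Automorphic Representations of Unitary Groups in Three Variables*, Ann. of Math. Stud. 123 (1990), §4.5 p. 50, p. 55.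
* [CartierCorvallis1979] P. Cartier, *Representations of 𝔭-adic groups: a survey*, PSPM 33.1 (1979), §IV (4.2)–(4.4), Thm. 4.1, Cor. 4.2.
* [Minguez2011] A. Mínguez, *Unramified representations of unitary groups* (2011), §4.
-/

set_option autoImplicit false
-- the mandated namespace repeats the single-problem summit's segment (`HodgeConjecture.HodgeConjecture`)
set_option linter.dupNamespace false

noncomputable section

open NumberField IsDedekindDomain Polynomial
open Literature.NumberTheory.Automorphic Literature.NumberTheory.Automorphic.HermitianLattice Literature.NumberTheory.Automorphic.UnitaryGroup

namespace Summit.HodgeConjecture.HodgeConjecture.R90.S6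

variable {F E : Type} [Field F] [NumberField F] [Field E] [NumberField E] [Algebra F E] [Algebra.IsQuadraticExtension F E]
  (c : E ≃ₐ[F] E) (hc1 : c ≠ 1) (v : HeightOneSpectrum (𝓞 F)) (w : PlacesOver E v) (hw : c • w.1 = w.1)
  (hv : Algebra.IsUnramifiedIn (𝓞 E) v.asIdeal)

/-- The exponent line of `U(2)`, `ℓ_m = (m, -m)`, is additive. [folklore] -/
private theorem line_two_add (a b : ℤ) :
    (fun i : Fin 2 => (a + b) * (1 - 2 * (i : ℕ))) = (fun i : Fin 2 => a * (1 - 2 * (i : ℕ))) + fun i : Fin 2 => b * (1 - 2 * (i : ℕ)) := by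
  funext i; simp only [Pi.add_apply]; ring

/-- **`λ_{(z,1)}(P(T₁)) = P(z + z⁻¹)` on `ℋ(U(J₀,2)(E_w), K₀)`**: for any Hecke operator `T₁` with `𝒮_w(T₁) = x^{(1,-1)} + x^{(-1,1)}`,
any polynomial `P` and any `z ∈ ℂˣ`, the unramified eigencharacter with torus parameter `(z, 1)` takes the value `P(z + z⁻¹)` at `P(T₁)`
(`λ_β = ev_β ∘ 𝒮_w`, `ev_{(z,1)}(x^{(1,-1)} + x^{(-1,1)}) = z + z⁻¹`). [cite: CartierCorvallis1979, §IV (4.2)–(4.4)] [cite: Rogawski1990, §4.5 p. 50] -/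
theorem unitaryHeckeEigencharacterAdic_two_aeval
    {T₁ : heckeAlgebra ℂ ↥(unitaryGroupOfForm (galAdicCompletionMap (L := E) c hw) ((StdForm.antidiagonal 2).over (w.1.adicCompletion E)))
      (unitaryInt (galAdicCompletionMap (L := E) c hw) ((StdForm.antidiagonal 2).over (w.1.adicCompletion E)))}
    (hT₁ : unitarySatakeTransformAdic c hc1 v w hw hv T₁ =
      AddMonoidAlgebra.single (fun i : Fin 2 => (1 : ℤ) * (1 - 2 * (i : ℕ))) (1 : ℂ) +
        AddMonoidAlgebra.single (fun i : Fin 2 => (-1 : ℤ) * (1 - 2 * (i : ℕ))) 1)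
    (P : ℂ[X]) (z : ℂˣ) :
    unitaryHeckeEigencharacterAdic c hc1 v w hw hv ![z, 1] (aeval T₁ P) = P.eval ((z : ℂ) + (z : ℂ)⁻¹) := by
  rw [← aeval_algHom_apply, unitaryHeckeEigencharacterAdic_apply, hT₁,
    laurentEvalAt_single_line_add (ℓ := fun m (i : Fin 2) => m * (1 - 2 * (i : ℕ))) line_two_add, coe_aeval_eq_eval]
  congr 1
  have hz : (∏ i : Fin 2, (((![z, 1] : Fin 2 → ℂˣ) i : ℂ) ^ ((1 : ℤ) * (1 - 2 * ((i : ℕ) : ℤ))))) = (z : ℂ) := by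
    rw [Fin.prod_univ_two]
    simp
  rw [hz]

/-- **`ℋ(U(J₀,2)(E_w), K₀) = ℂ[T₁]` at an inert unramified place**: there is a Hecke operator `T₁` with `𝒮_w(T₁) = x^{(1,-1)} + x^{(-1,1)}`
such that every element of the spherical Hecke algebra is a polynomial in `T₁` (the adic packaging of ★ `exists_generator_two`).
[cite: CartierCorvallis1979, §IV Thm. 4.1] [cite: Minguez2011, §4] -/
theorem exists_generator_unitaryHeckeAlgebraAdic_two :
    ∃ T₁ : heckeAlgebra ℂ ↥(unitaryGroupOfForm (galAdicCompletionMap (L := E) c hw) ((StdForm.antidiagonal 2).over (w.1.adicCompletion E)))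
        (unitaryInt (galAdicCompletionMap (L := E) c hw) ((StdForm.antidiagonal 2).over (w.1.adicCompletion E))),
      unitarySatakeTransformAdic c hc1 v w hw hv T₁ =
          AddMonoidAlgebra.single (fun i : Fin 2 => (1 : ℤ) * (1 - 2 * (i : ℕ))) (1 : ℂ) +
            AddMonoidAlgebra.single (fun i : Fin 2 => (-1 : ℤ) * (1 - 2 * (i : ℕ))) 1 ∧
      ∀ T, ∃ P : ℂ[X], aeval T₁ P = T := by
  haveI := finite_residueField_adicCompletion E w.1
  haveI := isHeckeTriple_unitaryInt_adicCompletion c v w hw ((StdForm.antidiagonal 2).over (w.1.adicCompletion E))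
  obtain ⟨T₁, hT₁, hgen⟩ := (unramifiedLocalConjDatum_localConjUniformizer c hc1 v w hw hv).exists_generator_two
    (exists_galAdicCompletionMap_ne c hc1 v w hw)
  refine ⟨T₁, ?_, hgen⟩
  rw [unitarySatakeTransformAdic_eq c hc1 v w hw hv (unramifiedLocalConjDatum_localConjUniformizer c hc1 v w hw hv)]
  exact hT₁

/-- **W3-b — the Satake-graph partner is unique** [Rogawski1990, p. 55 (`f ↦ ξ̂_H(f)`, `ξ̂_H(f)^∧(z) = f^∧(−z)`); CartierCorvallis1979 §IV Cor. 4.2]: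
two elements `φH, φH'` of `ℋ(U(J₀,2)(E_w), K₀)` with the same eigenvalues `λ_{(z,1)}(φH) = λ_{(z,1)}(φH')` for ALL `z ∈ ℂˣ` are equal —
write `φH = P(T₁)`, `φH' = P'(T₁)`; then `P(z + z⁻¹) = P'(z + z⁻¹)` for all `z`, `z ↦ z + z⁻¹` is onto `ℂ`, so `P = P'`.  (Sheet
`S6_wave3_targets.v1` :37–:41 token-for-token; supply lemma for (E1-c) `SatakeGraph` of `R90_S6_FloorE1D` and the S6 ED. 2b Hecke variation.)
[cite: Rogawski1990, §4.5 p. 50; p. 55] [cite: CartierCorvallis1979, §IV Thm. 4.1, Cor. 4.2] -/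
theorem satakeGraph_partner_unique
    (φH φH' : heckeAlgebra ℂ ↥(unitaryGroupOfForm (galAdicCompletionMap (L := E) c hw) ((StdForm.antidiagonal 2).over (w.1.adicCompletion E)))
        (unitaryInt (galAdicCompletionMap (L := E) c hw) ((StdForm.antidiagonal 2).over (w.1.adicCompletion E))))
    (h : ∀ z : ℂˣ, unitaryHeckeEigencharacterAdic c hc1 v w hw hv ![z, 1] φH = unitaryHeckeEigencharacterAdic c hc1 v w hw hv ![z, 1] φH') :
    φH = φH' := by
  obtain ⟨T₁, hT₁, hgen⟩ := exists_generator_unitaryHeckeAlgebraAdic_two c hc1 v w hw hv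
  obtain ⟨P, rfl⟩ := hgen φH
  obtain ⟨P', rfl⟩ := hgen φH'
  have hPP' : P = P' := by
    refine Polynomial.funext fun t => ?_
    obtain ⟨z, hz⟩ := exists_units_add_inv_eq t
    rw [← hz, ← unitaryHeckeEigencharacterAdic_two_aeval c hc1 v w hw hv hT₁ P z,
      ← unitaryHeckeEigencharacterAdic_two_aeval c hc1 v w hw hv hT₁ P' z]
    exact h z
  rw [hPP']

end Summit.HodgeConjecture.HodgeConjecture.R90.S6

end
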